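import Literature.Topology.FourManifolds.BallUnionDiscLocalHomology
import Literature.AlgebraicTopology.SingularHomology.LocalHomologyUniverse
import Literature.AlgebraicTopology.SingularHomology.EulerCharacteristicTriple

/-!
# Aux file 2 of stub `stub_friendsH2` (line `mk_friends`, crux `DcrGap`): local homology in `S⁴`
(item stmt-SmoothPoincare4-16128, route route-SmoothPoincare4-DottedCircleRasmussen)

The `S⁴`-side inputs of the `H₂`-leaf of the friends lemma (Manolescu–Piccirillo 2023, §3.2, proof
of Lemma 3.3, the `k ≥ 1` analogue of the tree's `BallUnionDiscLocalHomology.lean`), all read off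
from Hatcher's Prop. 2B.1 through the tree's sphere-complement theorems, with `ℚ`-coefficients where
ranks are counted:

* `FriendsH2.surjective_restrictLocal_of_isIso` — `H_q(Z | K) → H_q(Z | L)` is onto as soon as
  `H_q(Z) → H_q(Z | L)` is an isomorphism (no hypothesis on `K ⊇ L`);
* the embedded circle `Γ ⊂ S⁴`: `H₂(S⁴ | Γ) = 0`, `H₃(S⁴ | Γ; ℚ) ≅ ℚ` (finite, rank one),
  `H₄(S⁴) ≅ H₄(S⁴ | Γ)`, hence every restriction `H₄(S⁴ | K) → H₄(S⁴ | Γ)` is onto;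
* sets with acyclic complement (injected cubes) and points: `H_q(S⁴ | ·) = 0` for `q = 2, 3`, and the
  union of a closed set with vanishing `H₂, H₃` and a far point;
* `H_q(S⁴; ℚ) = 0` (`q = 1, 2, 3`) and, for closed `K ⊆ S⁴`, `H₃(S⁴ | K) ≅ H₂(S⁴ ∖ K)`,
  `H₂(S⁴ | K) ≅ H₁(S⁴ ∖ K)` (long exact sequence of the pair).

Everything is proved; no definitions, no named facts, no `sorry`.

## References

* A. Hatcher, *Algebraic Topology*, CUP 2002, Thm. 2.16, Prop. 2B.1, §3.3 p. 231. [HatcherAT2002]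
* C. Manolescu, L. Piccirillo, J. Lond. Math. Soc. 108 (2023), §3.2. [ManolescuPiccirillo2023]
-/

-- the prescribed namespace `Summit.<P>.<Sub>.…` duplicates `SmoothPoincare4` (P = Sub)
set_option linter.dupNamespace false
set_option linter.style.longLine false

noncomputable section

open CategoryTheory Limits Set Function Metric Topology
open Literature.AlgebraicTopology.SingularHomology Literature.Topology.FourManifolds

universe u

namespace Summit.SmoothPoincare4.SmoothPoincare4.Theorems.DcrGap.MkFriends

namespace FriendsH2

/-- Local notation: the `4`-sphere `S⁴ ⊂ ℝ⁵`. -/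
local notation "𝕊⁴" => (Metric.sphere (0 : EuclideanSpace ℝ (Fin 5)) 1)

/-! ## Generalities -/

section General

variable (R : Type) [CommRing R] (M : Type) [AddCommGroup M] [Module R M]
variable {Z : Type u} [TopologicalSpace Z]

/-- **`H_q(Z | K) → H_q(Z | L)` is onto when `j_* : H_q(Z) → H_q(Z | L)` is an isomorphism**
(`j_*` for `L` factors through the restriction from `K ⊇ L`; Hatcher 2002, §2.1 functoriality of
the sequence of pairs). [folklore] -/
theorem surjective_restrictLocal_of_isIso {K L : Set Z} (h : L ⊆ K) (q : ℕ)
    [IsIso (relativeSingularHomology.ofAbsolute R M Z Lᶜ q)] :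
    Surjective (restrictLocal R M h q) := by
  have hfac : (restrictLocal R M h q : _ → _) ∘ (relativeSingularHomology.ofAbsolute R M Z Kᶜ q : _ → _) =
      (relativeSingularHomology.ofAbsolute R M Z Lᶜ q : _ → _) := by
    funext x
    change (relativeSingularHomology.ofAbsolute R M Z Kᶜ q ≫ restrictLocal R M h q) x = _
    rw [ofAbsolute_comp_restrictLocal]
  have hsurj : Surjective (relativeSingularHomology.ofAbsolute R M Z Lᶜ q : _ → _) :=
    (ModuleCat.epi_iff_surjective _).1 inferInstance
  rw [← hfac] at hsurj
  exact Surjective.of_comp hsurj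

/-- `H_k(Z | ∅) = H_k(Z, Z) = 0`. [folklore] -/
theorem isZero_localHomologyOfSet_empty (k : ℕ) : IsZero (localHomologyOfSet R M Z (∅ : Set Z) k) := by
  change IsZero (relativeSingularHomology R M Z (∅ : Set Z)ᶜ k)
  rw [Set.compl_empty]
  exact isZero_relativeSingularHomology_univ R M k

/-- **A far point does not change `H₂`, `H₃` of the local homology**: in a Hausdorff space charted
on `ℝ⁴`, if `D` is closed, `x ∉ D` and `H_q(Z | D) = 0` for some `q ∈ {2, 3}` (indeed any
`q ≠ 4`), then `H_q(Z | D ∪ {x}) = 0` (relative Mayer–Vietoris with `D ∩ {x} = ∅` and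
`H_q(Z | x) = 0`, Hatcher Lemma 3.27 / §3.3 p. 231). [cite: HatcherAT2002, §3.3 p. 231] -/
theorem isZero_localHomologyOfSet_union_singleton [T2Space Z] [ChartedSpace (EuclideanSpace ℝ (Fin 4)) Z]
    {D : Set Z} (hD : IsClosed D) {x : Z} (hx : x ∉ D) {q : ℕ} (hq : q ≠ 4)
    (hD0 : IsZero (localHomologyOfSet R M Z D q)) :
    IsZero (localHomologyOfSet R M Z (D ∪ {x}) q) := by
  refine localHomologyOfSet.isZero_localHomologyOfSet_union R M hD isClosed_singleton q hD0
    (isZero_localHomology_of_ne R M x hq) ?_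
  have he : D ∩ {x} = ∅ := Set.inter_singleton_eq_empty.2 hx
  haveI : Subsingleton (localHomologyOfSet R M Z (D ∩ {x}) (q + 1)) := by
    rw [he]
    exact ModuleCat.subsingleton_of_isZero (isZero_localHomologyOfSet_empty R M (q + 1))
  intro t
  exact ⟨0, Subsingleton.elim _ _⟩

end General

/-! ## The sphere `S⁴` -/

section Sphere

variable (R : Type) [CommRing R] (M : Type) [AddCommGroup M] [Module R M]

/-- **The stereographic open embedding `σ : ℝ⁴ → S⁴` onto the complement of the north pole `N`**
(`SphereComplement.sphereMinusPointHomeomorph`), with its range made explicit. [folklore] -/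
theorem exists_isOpenEmbedding_range_eq_compl_singleton :
    ∃ (N : 𝕊⁴) (σ : EuclideanSpace ℝ (Fin 4) → 𝕊⁴), IsOpenEmbedding σ ∧ range σ = {N}ᶜ := by
  let N : 𝕊⁴ := ⟨EuclideanSpace.single 0 1, by simp⟩
  refine ⟨N, Subtype.val ∘ (SphereComplement.sphereMinusPointHomeomorph N).symm, ?_, ?_⟩
  · exact (isOpen_compl_singleton.isOpenEmbedding_subtypeVal).comp
      (SphereComplement.sphereMinusPointHomeomorph N).symm.isOpenEmbedding
  · rw [range_comp, EquivLike.range_eq_univ, image_univ, Subtype.range_coe]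

/-- `H_q(S⁴; M) = 0` for `q = 1, 2, 3`. [cite: HatcherAT2002, Cor. 2.14] -/
theorem isZero_singularHomology_sphere_four {q : ℕ} (h0 : q ≠ 0) (h4 : q < 4) :
    IsZero (singularHomology R M 𝕊⁴ q) :=
  isZero_singularHomology_sphere_holds R M (n := 4) (k := q) (by omega) (by omega)

/-- **`H₂(S⁴ | Γ) = 0` for an embedded circle `Γ`** (`H₂(S⁴) = 0` and `H₁(S⁴ ∖ Γ) = 0`,
Hatcher Prop. 2B.1(b)). [cite: HatcherAT2002, Prop. 2B.1(b)] -/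
theorem isZero_localHomologyOfSet_circle_two
    (γ : Metric.sphere (0 : EuclideanSpace ℝ (Fin 2)) 1 → 𝕊⁴) (hγ : IsEmbedding γ) :
    IsZero (localHomologyOfSet R M 𝕊⁴ (range γ) 2) :=
  isZero_localHomologyOfSet_succ_of_isZero R M _ 1
    (isZero_singularHomology_sphere_four R M (by omega) (by omega))
    (isZero_singularHomology_compl_range_circle_sphere_four R M γ hγ one_ne_zero (by omega))

/-- **`H₄(S⁴) ≅ H₄(S⁴ | Γ)` for an embedded circle `Γ`** (the complement has no homology in degrees
`3, 4`, Hatcher Prop. 2B.1(b)). [cite: HatcherAT2002, Prop. 2B.1(b)] -/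
theorem isIso_ofAbsolute_circle_four
    (γ : Metric.sphere (0 : EuclideanSpace ℝ (Fin 2)) 1 → 𝕊⁴) (hγ : IsEmbedding γ) :
    IsIso (relativeSingularHomology.ofAbsolute R M 𝕊⁴ (range γ)ᶜ 4) :=
  isIso_ofAbsolute_sphere_four_of_acyclic_compl R M
    (isZero_singularHomology_compl_range_circle_sphere_four R M γ hγ (by omega) (by omega))
    (isZero_singularHomology_compl_range_circle_sphere_four R M γ hγ (by omega) (by omega))

/-- **Every restriction `H₄(S⁴ | K) → H₄(S⁴ | Γ)` onto an embedded circle `Γ ⊆ K` is onto.**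
[cite: HatcherAT2002, Prop. 2B.1(b)] -/
theorem surjective_restrictLocal_circle_four
    (γ : Metric.sphere (0 : EuclideanSpace ℝ (Fin 2)) 1 → 𝕊⁴) (hγ : IsEmbedding γ)
    {K : Set 𝕊⁴} (h : range γ ⊆ K) : Surjective (restrictLocal R M h 4) := by
  haveI := isIso_ofAbsolute_circle_four R M γ hγ
  exact surjective_restrictLocal_of_isIso R M h 4

/-- **`H₃(S⁴ | Γ; ℚ)` is one-dimensional** for an embedded circle `Γ` (`≅ H₂(S⁴ ∖ Γ; ℚ) ≅ ℚ`,
Hatcher Prop. 2B.1(b)). [cite: HatcherAT2002, Prop. 2B.1(b)] -/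
theorem finite_and_finrank_localHomologyOfSet_circle_three
    (γ : Metric.sphere (0 : EuclideanSpace ℝ (Fin 2)) 1 → 𝕊⁴) (hγ : IsEmbedding γ) :
    Module.Finite ℚ (localHomologyOfSet ℚ ℚ 𝕊⁴ (range γ) 3) ∧
      Module.finrank ℚ (localHomologyOfSet ℚ ℚ 𝕊⁴ (range γ) 3) = 1 := by
  obtain ⟨T⟩ := nonempty_localHomologyOfSet_sphere_four_circle_three_linearEquiv ℚ ℚ γ hγ
  refine ⟨Module.Finite.equiv T.symm, ?_⟩
  rw [T.finrank_eq, finrank_ulift, Module.finrank_self]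

/-- **`H_q(S⁴ | D) = 0`, `q = 2, 3`, for the image `D` of an injective continuous cube**
(acyclic complement, Hatcher Prop. 2B.1(a)). [cite: HatcherAT2002, Prop. 2B.1(a)] -/
theorem isZero_localHomologyOfSet_cube {k : ℕ} (ξ : C((Fin k → unitInterval), 𝕊⁴)) (hξ : Injective ξ)
    {q : ℕ} (hq2 : 2 ≤ q) (hq3 : q ≤ 3) :
    IsZero (localHomologyOfSet R M 𝕊⁴ (range ξ) q) :=
  isZero_localHomologyOfSet_sphere_four_of_acyclic_compl R M
    (isZero_singularHomology_compl_range_cube_sphere_four R M ξ hξ) hq2 hq3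

/-- **The long exact sequence of `(S⁴, S⁴ ∖ K)` in low degrees**: `H₃(S⁴ | K) ≅ H₂(S⁴ ∖ K)` and
`H₂(S⁴ | K) ≅ H₁(S⁴ ∖ K)` (Hatcher Thm. 2.16 with `H_q(S⁴) = 0`, `q = 1, 2, 3`).
[cite: HatcherAT2002, Thm. 2.16] -/
theorem nonempty_linearEquiv_compl_sphere_four (K : Set 𝕊⁴) :
    Nonempty (localHomologyOfSet R M 𝕊⁴ K 3 ≃ₗ[R] singularHomology R M ↥(Kᶜ) 2) ∧
      Nonempty (localHomologyOfSet R M 𝕊⁴ K 2 ≃ₗ[R] singularHomology R M ↥(Kᶜ) 1) :=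
  ⟨exists_linearEquiv_compl_of_isZero R M K 2
      (isZero_singularHomology_sphere_four R M (by omega) (by omega))
      (isZero_singularHomology_sphere_four R M (by omega) (by omega)),
    exists_linearEquiv_compl_of_isZero R M K 1
      (isZero_singularHomology_sphere_four R M (by omega) (by omega))
      (isZero_singularHomology_sphere_four R M (by omega) (by omega))⟩

end Sphere

end FriendsH2

/-- **Registered helper (aux 2 of `stub_friendsH2`)**: the stereographic open embedding `σ : ℝ⁴ → S⁴` onto the complement of a point. [folklore] -/
theorem helper_friendsH2_sphereFour : ∃ (N : (Metric.sphere (0 : EuclideanSpace ℝ (Fin 5)) 1)) (σ : EuclideanSpace ℝ (Fin 4) → (Metric.sphere (0 : EuclideanSpace ℝ (Fin 5)) 1)), Topology.IsOpenEmbedding σ ∧ Set.range σ = {N}ᶜ := FriendsH2.exists_isOpenEmbedding_range_eq_compl_singleton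

end Summit.SmoothPoincare4.SmoothPoincare4.Theorems.DcrGap.MkFriends

end
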